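import Literature.AlgebraicGeometry.ModuliOfSheaves.KummerModuliRestrictionInvariants
import Literature.AlgebraicGeometry.ModuliOfSheaves.SheafModuliCohomologyGenerators
import Literature.AlgebraicGeometry.Hyperkaehler.LLVGenerationTransport
import Summits.Ventures.HodgeKum4.Theorems.KummerFixedLocusHilbertKummerTransferAlgebra
import HarnessLib
import HarnessLib.Audit

/-!
# KummerModuliInvolutionParity — "LEMMA P" of the crux idea reduced to its geometric core: an automorphism of `M_H(v)` acting by PARITY on Markman's generators acts by parity on all of `H*(M_H(v); ℂ)` (T2), and an automorphism of `K_H(v)` that it extends fixes every `Γ(K)`-invariant class of even degree (T1); every other automorphism with the same `H² ∕ H³`-action does too (kernel theorems; nothing asserted)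

Summit `HodgeConjecture/HodgeConjecture`; seat `vhodge-19149-w3`; companion of
`Theorems/KummerModuliInvariantsByMarkmanOnM.lean` (crux idea `kummer-moduli-invariants-by-markman-on-m`, input
"T3 = LEMMA P").  FILING ANCHOR `--supports stmt-HodgeConjecture-19149` (director's instruction); mathematical
target = the `K_H(v)` rung (`Theorems.HC_KummerSheafModuliSpace`); NO bearing on Weil sixfolds.
HONEST FRAMING: every theorem is proved in the kernel from NAMED hypotheses — T1
`ModuliOfSheaves.Yoshioka2001_kummerFibre_restrictionImage`, T2
`ModuliOfSheaves.Markman2002_kunnethFactors_generate_cohomology_sheafModuli` — and ONE explicit GEOMETRIC hypothesis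
`hgeo` (below), which is NOT a fact and NOT proved here.  Nothing asserts `HodgeConjecture`, `HC_AV`, `W₆`,
`HC_Kum4Type`, `HC_KummerSheafModuliSpace` or the Hodge conjecture for any single `K_H(v)`.

## LEMMA P (hodge-lit-oqh-1 g8, `vhodge/lit-oqh/staging/hodge-lit-oqh-1/OQH3-RESTATEMENT-oqh1-g8.md`) and what is kernel here

LEMMA P (seat derivation, to be refereed): on a fine `M = M_H(v)` over the abelian surface `A`, the involution
`ι_M : E ↦ (−1_A)^* E` composed with a translation of the `A × Â`-action preserves the Albanese fibre `K = K_H(v)`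
[(a)–(b): universal property, `𝔞_v ∘ ι_M = −𝔞_v + const`, Yoshioka's `Φ`], and acts on `H*(M; ℚ)` by `(−1)^{deg}`
because `(1 × ι_M)^* 𝒸 = ((−1) × 1)^* 𝒸` for the normalised Chern character `𝒸` of `ℰ`, so that each Künneth factor
`u_s` of `𝒸` satisfies `ι_M^* u_s = (−1)^{deg u_s} u_s` [(d), first half] and the two ring endomorphisms `ι_M^*`,
`(−1)^{deg}` of `H*(M)` agree on Markman's generators, hence everywhere [(c)–(d), second half: Markman 2002
Cor. 2]; so `ι_M|_K` acts as `+1 ∕ −1` on `H² ∕ H³(K)` and fixes `Im(H^{2n}(M) → H^{2n}(K)) ⊇ H^{2n}(K)^{Γ}`, and any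
OTHER automorphism with the same `H² ∕ H³`-action differs from it by an element of `Γ(K) = autFixingH2H3 K`.
KERNEL HERE: the second half of (d) (`totalPullback_eq_parityOp_of_kunnethGenerators`: T2's minimality form
`….eq_top_of_abelianSurface` applied to the equaliser of the two multiplicative unital endomorphisms `g^*` and
`P = (−1)^{deg}` — `Summit.Ventures.HodgeKum4.HilbertKummer.parityOp`), the restriction step (T1: `H²`, `H³` and the
`Γ`-invariants are restricted classes), and the "differ by `Γ(K)`" step (the DEFINITION of `autFixingH2H3`).
HYPOTHESIS `hgeo` (the first halves, geometric): there are `ι₀ ∈ Aut K` and `g : M ⟶ M` with `ι₀ ≫ j = j ≫ g`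
(`g` extends `ι₀` along the fibre inclusion `j`) and `g^* x = (−1)^{deg x} x` for every Künneth generator `x` of
`ch(ℰ)` (`ModuliOfSheaves.kunnethGenerators`).  Typing `hgeo` as a theorem needs scheme-level carriers the tree does
not have (the classifying automorphism of the fine moduli space, `ch` of pull-backs of the non-locally-free
universal sheaf — `ChernCharacterBetti.map_ch` is stated for vector bundles —, the `A × Â`-action); recorded, not
attempted.

## What is proved (K = kernel)

* `totalPullback_eq_parityOp_of_kunnethGenerators` (T2): parity on the generators ⟹ parity on `H*(M(ℂ); ℂ)`;
  degreewise `map_eq_neg_one_pow_smul_of_kunnethGenerators`: `g^* = (−1)ᵏ` on `Hᵏ(M(ℂ); ℂ)`.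
* `map_eq_neg_one_pow_smul_of_extends`: if `ι₀ ≫ j = j ≫ g` and `g^* = (−1)ᵏ` on `Hᵏ(M)`, then `ι₀^* c = (−1)ᵏ c`
  for every RESTRICTED class `c ∈ Im j^*`.
* `involutionParity_of_parityOnGenerators` (T1 + T2 + `hgeo`): **every `ι ∈ Aut K` acting as `+1` on `H²(K)` and
  `−1` on `H³(K)` fixes every `Γ(K)`-invariant class of `H^{2n}(K(ℂ); ℂ)`** — the hypothesis `hA5` of the kum4
  cell's `kum4FixedFourfoldClasses_of_facts` AT the Kummer moduli space (`n = 4`: the shape `hP` consumed by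
  `Theorems/KummerModuliKumFourClosure.lean`), i.e. LEMMA P's conclusion, from its geometric core.

## What this is NOT

Not a discharge of LEMMA P: `hgeo` is an explicit hypothesis.  No new definition, no new named fact.
-/

noncomputable section

open CategoryTheory MonoidalCategory
open Literature.AlgebraicTopology.SingularHomology
open Literature.AlgebraicGeometry Literature.AlgebraicGeometry.HodgeTheory
  Literature.AlgebraicGeometry.Hyperkaehler Literature.AlgebraicGeometry.ModuliOfSheaves
open Literature.AlgebraicGeometry.Motives (SchemeOver AbelianVariety IsSmoothProjective ComplexPoints fiberOver
  fiberι)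
open Summit.Ventures.HodgeKum4.HilbertKummer (parityOp parityOp_ofDegree parityOp_totalCup)

-- `Summit.<Summit>.<Problem>` is the mandated summit-side namespace (CONVENTIONS §2); for the
-- single-conjunct summit `HodgeConjecture` the two coincide, so the duplicate is deliberate.
set_option linter.dupNamespace false

namespace Summit.HodgeConjecture.HodgeConjecture.Theorems.KummerModuliMarkmanOnM

variable {n d : ℕ} {C : ChernCharacterBetti} {A : AbelianVariety ℂ} {p : complexBetti A.X (2 * 2)}
  {H : complexBetti A.X (2 * 1)} {v : (i : ℕ) → complexBetti A.X (2 * i)} {M : SchemeOver ℂ}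
  {E : (A.X ⊗ M).left.Modules} {T : AbelianVariety ℂ} {f : M ⟶ T.X} {t : ComplexPoints T.X} {K : SchemeOver ℂ}

/-! ### §A  Parity on Markman's generators is parity on `H*(M_H(v))` (T2) -/

/-- **An endomorphism `g` of the fine moduli space `M_H(v)` that acts by `(−1)^{deg}` on the Künneth factors of
`ch(ℰ)` acts by `(−1)^{deg}` on all of `H*(M(ℂ); ℂ)`** — the equaliser of the two multiplicative unital
endomorphisms `g^*` (`totalPullback`) and `P` (`parityOp`) of `H*(M)` is a cup-closed submodule containing `1` and
the generators, hence everything by Markman 2002 Cor. 2 (`….eq_top_of_abelianSurface`).  Kernel, modulo T2.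
[cite: Markman2002Generators, Cor. 2 (§2; arXiv:math/0009109 p. 3)] [cite: Hatcher2002, §3.2 Prop. 3.10] -/
theorem totalPullback_eq_parityOp_of_kunnethGenerators
    (hMk : Markman2002_kunnethFactors_generate_cohomology_sheafModuli) (hM : AbelianSurfaceSheafModuli C A p H v M E)
    (hMd : IsSmoothProjective d M) (μ : HomologicalOrientation ℂ (ComplexPoints (M ⊗ A.X)) (2 * (d + 2)))
    (ν : HomologicalOrientation ℂ (ComplexPoints M) (2 * d)) (hμ : μ.HasPoincareDuality)
    (hν : ν.HasPoincareDuality) (g : M ⟶ M)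
    (hg : ∀ x ∈ kunnethGenerators C A.X M E μ ν,
      totalPullback ℂ (Motives.AlgPoints.mapContinuous (L := ℂ) g) x = parityOp ℂ (ComplexPoints M) x) :
    totalPullback ℂ (Motives.AlgPoints.mapContinuous (L := ℂ) g) = parityOp ℂ (ComplexPoints M) := by
  have hW := hMk.eq_top_of_abelianSurface hM hMd μ ν hμ hν
    (W := LinearMap.eqLocus (totalPullback ℂ (Motives.AlgPoints.mapContinuous (L := ℂ) g))
      (parityOp ℂ (ComplexPoints M))) (fun x hx ↦ hg x hx) ?_ ?_
  · refine LinearMap.ext fun x ↦ ?_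
    have hx : x ∈ LinearMap.eqLocus (totalPullback ℂ (Motives.AlgPoints.mapContinuous (L := ℂ) g))
        (parityOp ℂ (ComplexPoints M)) := by
      rw [hW]
      exact Submodule.mem_top
    exact hx
  · change totalPullback ℂ _ (ofDegree ℂ (ComplexPoints M) 0 (singularCohomology.one ℂ (ComplexPoints M))) =
      parityOp ℂ (ComplexPoints M) (ofDegree ℂ (ComplexPoints M) 0 (singularCohomology.one ℂ (ComplexPoints M)))
    rw [totalPullback_lof, singularCohomology.map_one, parityOp_ofDegree, pow_zero, one_smul]
  · intro x hx y hy
    change totalPullback ℂ _ (totalCup ℂ (ComplexPoints M) x y) =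
      parityOp ℂ (ComplexPoints M) (totalCup ℂ (ComplexPoints M) x y)
    rw [LinearMap.mem_eqLocus] at hx hy
    rw [totalPullback_totalCup, parityOp_totalCup, hx, hy]

/-- **Degreewise: such a `g` acts on `Hᵏ(M_H(v)(ℂ); ℂ)` as the scalar `(−1)ᵏ`.** Kernel, modulo T2.
[cite: Markman2002Generators, Cor. 2] -/
theorem map_eq_neg_one_pow_smul_of_kunnethGenerators
    (hMk : Markman2002_kunnethFactors_generate_cohomology_sheafModuli) (hM : AbelianSurfaceSheafModuli C A p H v M E)
    (hMd : IsSmoothProjective d M) (μ : HomologicalOrientation ℂ (ComplexPoints (M ⊗ A.X)) (2 * (d + 2)))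
    (ν : HomologicalOrientation ℂ (ComplexPoints M) (2 * d)) (hμ : μ.HasPoincareDuality)
    (hν : ν.HasPoincareDuality) (g : M ⟶ M)
    (hg : ∀ x ∈ kunnethGenerators C A.X M E μ ν,
      totalPullback ℂ (Motives.AlgPoints.mapContinuous (L := ℂ) g) x = parityOp ℂ (ComplexPoints M) x)
    (k : ℕ) (u : complexBetti M k) : (complexBetti.map g k).hom u = ((-1 : ℂ) ^ k) • u := by
  have h := LinearMap.congr_fun (totalPullback_eq_parityOp_of_kunnethGenerators hMk hM hMd μ ν hμ hν g hg)
    (ofDegree ℂ (ComplexPoints M) k u)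
  rw [totalPullback_lof, parityOp_ofDegree, ← map_smul] at h
  have hinj : Function.Injective (ofDegree ℂ (ComplexPoints M) k) := fun a b hab ↦ DirectSum.of_injective k hab
  exact hinj h

/-! ### §B  Restricted classes see the parity (T1's inclusion `j`) -/

/-- **If `g` extends `ι₀ ∈ Aut K` along `j : K ⟶ M` (`ι₀ ≫ j = j ≫ g`) and `g^* = (−1)ᵏ` on `Hᵏ(M)`, then
`ι₀^* c = (−1)ᵏ c` for every restricted class `c ∈ Im(j^* : Hᵏ(M) → Hᵏ(K))`** (naturality of pull-back).
[cite: Hatcher2002, §3.1 "Induced homomorphisms"] -/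
theorem map_eq_neg_one_pow_smul_of_extends {j : K ⟶ M} (ι₀ : Aut K) (g : M ⟶ M) (hext : ι₀.hom ≫ j = j ≫ g)
    (hg : ∀ (k : ℕ) (u : complexBetti M k), (complexBetti.map g k).hom u = ((-1 : ℂ) ^ k) • u) {k : ℕ}
    {c : complexBetti K k} (hc : c ∈ LinearMap.range (complexBetti.map j k).hom) :
    (complexBetti.map ι₀.hom k).hom c = ((-1 : ℂ) ^ k) • c := by
  obtain ⟨u, rfl⟩ := hc
  have h1 : (complexBetti.map ι₀.hom k).hom ((complexBetti.map j k).hom u) =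
      (complexBetti.map (ι₀.hom ≫ j) k).hom u := by
    rw [complexBetti.map_comp, ModuleCat.hom_comp, LinearMap.comp_apply]
  rw [h1, hext, complexBetti.map_comp, ModuleCat.hom_comp, LinearMap.comp_apply, hg, map_smul]

/-! ### §C  LEMMA P from its geometric core (T1 + T2 + `hgeo`) -/

/-- **The involution parity at a Kummer moduli space `K_H(v)` from its geometric core.**  For `n ≥ 2`, a fine
smooth projective `(2n+4)`-dimensional `(M, ℰ) = M_H(v)` on the abelian surface `A`, a Kummer moduli space
`K ≅ f⁻¹(t) ↪ M` of `Kumⁿ`-type (`j = e.hom ≫ fiberι f t`), orientations with Poincaré duality, and the GEOMETRIC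
hypothesis `hgeo` — some `ι₀ ∈ Aut K` extends along `j` to `g : M ⟶ M` acting by `(−1)^{deg}` on the Künneth
factors of `ch(ℰ)` —: **every automorphism `ι` of `K` acting as `+1` on `H²(K(ℂ); ℂ)` and as `−1` on
`H³(K(ℂ); ℂ)` fixes every `Γ(K)`-invariant class of `H^{2n}(K(ℂ); ℂ)`.**  Steps: `g^* = (−1)^{deg}` on `H*(M)` (§A,
T2); `ι₀^* = (−1)ᵏ` on `Im j^*`, which is all of `H²`, `H³` and contains the `Γ`-invariants (T1); `ι` and `ι₀`
differ by `γ = ι₀⁻¹ι ∈ autFixingH2H3 K` (definition), and `γ` fixes `Γ`-invariant classes.  Kernel, modulo T1, T2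
and `hgeo`; this is the hypothesis `hP` of `Theorems/KummerModuliKumFourClosure.lean` at `n = 4`.
[cite: Markman2002Generators, Cor. 2] [cite: Yoshioka2001AbelianSurfaces, §4.1 with Thm. 0.2 (2) and Prop. 4.20] -/
theorem involutionParity_of_parityOnGenerators (hY : Yoshioka2001_kummerFibre_restrictionImage)
    (hMk : Markman2002_kunnethFactors_generate_cohomology_sheafModuli) (hn : 2 ≤ n)
    (hM : AbelianSurfaceSheafModuli C A p H v M E) (hMd : IsSmoothProjective (2 * n + 4) M)
    (e : K ≅ fiberOver f t) (hK : IsSmoothProjective (2 * n) K) (hKum : IsOfGeneralizedKummerType n K)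
    (μ : HomologicalOrientation ℂ (ComplexPoints (M ⊗ A.X)) (2 * (2 * n + 4 + 2)))
    (ν : HomologicalOrientation ℂ (ComplexPoints M) (2 * (2 * n + 4))) (hμ : μ.HasPoincareDuality)
    (hν : ν.HasPoincareDuality)
    (hgeo : ∃ (ι₀ : Aut K) (g : M ⟶ M), ι₀.hom ≫ (e.hom ≫ fiberι f t) = (e.hom ≫ fiberι f t) ≫ g ∧
      ∀ x ∈ kunnethGenerators C A.X M E μ ν,
        totalPullback ℂ (Motives.AlgPoints.mapContinuous (L := ℂ) g) x = parityOp ℂ (ComplexPoints M) x)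
    (ι : Aut K) (h2 : complexBetti.map ι.hom 2 = 𝟙 _) (h3 : complexBetti.map ι.hom 3 = -𝟙 _)
    (c : complexBetti K (2 * n))
    (hc : ∀ γ : Aut K, γ ∈ autFixingH2H3 K → (complexBetti.map γ.hom (2 * n)).hom c = c) :
    (complexBetti.map ι.hom (2 * n)).hom c = c := by
  obtain ⟨ι₀, g, hext, hgG⟩ := hgeo
  have hg := map_eq_neg_one_pow_smul_of_kunnethGenerators hMk hM hMd μ ν hμ hν g hgG
  -- `ι₀` on restricted classes
  have hι₀ : ∀ {k : ℕ} {c' : complexBetti K k},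
      c' ∈ LinearMap.range (complexBetti.map (e.hom ≫ fiberι f t) k).hom →
        (complexBetti.map ι₀.hom k).hom c' = ((-1 : ℂ) ^ k) • c' :=
    fun hc' ↦ map_eq_neg_one_pow_smul_of_extends ι₀ g hext hg hc'
  have hι₀2 : complexBetti.map ι₀.hom 2 = 𝟙 _ := by
    ext c'
    have hc' : c' ∈ LinearMap.range (complexBetti.map (e.hom ≫ fiberι f t) 2).hom := by
      rw [hY.range_two hn hM hMd e hK hKum]
      exact Submodule.mem_top
    rw [hι₀ hc']
    norm_num
  have hι₀3 : complexBetti.map ι₀.hom 3 = -𝟙 _ := by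
    ext c'
    have hc' : c' ∈ LinearMap.range (complexBetti.map (e.hom ≫ fiberι f t) 3).hom := by
      rw [hY.range_three hn hM hMd e hK hKum]
      exact Submodule.mem_top
    rw [hι₀ hc', ModuleCat.hom_neg]
    norm_num
  -- the inverse of `ι₀` on `H²`, `H³`
  have hinv2 : complexBetti.map ι₀.inv 2 = 𝟙 _ := by
    have h := complexBetti.map_comp ι₀.inv ι₀.hom 2
    rw [ι₀.inv_hom_id, complexBetti.map_id, hι₀2, Category.id_comp] at h
    exact h.symm
  have hinv3 : complexBetti.map ι₀.inv 3 = -𝟙 _ := by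
    have h := complexBetti.map_comp ι₀.inv ι₀.hom 3
    rw [ι₀.inv_hom_id, complexBetti.map_id, hι₀3, Preadditive.neg_comp, Category.id_comp] at h
    rw [← neg_neg (complexBetti.map ι₀.inv 3), ← h]
  -- `γ = ι₀⁻¹ ι ∈ Γ(K)`
  set γ : Aut K := ι₀.symm ≪≫ ι with hγdef
  have hγ : γ ∈ autFixingH2H3 K := by
    refine (Hyperkaehler.mem_autFixingH2H3_iff γ).2 ⟨?_, ?_⟩
    · change complexBetti.map (ι₀.inv ≫ ι.hom) 2 = 𝟙 _
      rw [complexBetti.map_comp, h2, hinv2, Category.comp_id]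
    · change complexBetti.map (ι₀.inv ≫ ι.hom) 3 = 𝟙 _
      rw [complexBetti.map_comp, h3, hinv3, Preadditive.neg_comp_neg, Category.comp_id]
  -- `ι = ι₀ ≫ γ`, and both fix `c`
  have hιfac : ι.hom = ι₀.hom ≫ γ.hom := by
    change ι.hom = ι₀.hom ≫ (ι₀.inv ≫ ι.hom)
    rw [ι₀.hom_inv_id_assoc]
  have hcr : c ∈ LinearMap.range (complexBetti.map (e.hom ≫ fiberι f t) (2 * n)).hom :=
    hY.mem_range_of_forall_autFixingH2H3 hn hM hMd e hK hKum (2 * n) fun γ' hγ' ↦ hc γ' hγ'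
  have heven : ((-1 : ℂ) ^ (2 * n)) = 1 := by
    rw [pow_mul, neg_one_sq, one_pow]
  rw [hιfac, complexBetti.map_comp, ModuleCat.hom_comp, LinearMap.comp_apply, hc γ hγ, hι₀ hcr, heven, one_smul]

/-- **Bundled over a presentation, in the kum4 cell's degreewise vocabulary at `n = 4`** (`2 · 4 = 8`,
`Summit.Ventures.HodgeKum4.IsGammaInvariant` has the same body as the hypothesis above): the exact shape `hP`
consumed by `hodgeConjectureFor_kumFour_of_involutionParity`.  Kernel, modulo T1, T2 and `hgeo`.
[cite: Markman2002Generators, Cor. 2] [cite: Yoshioka2001AbelianSurfaces, §4.1 with Thm. 0.2 (2) and Prop. 4.20] -/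
theorem involutionParity_four_of_parityOnGenerators (hY : Yoshioka2001_kummerFibre_restrictionImage)
    (hMk : Markman2002_kunnethFactors_generate_cohomology_sheafModuli)
    (hM : AbelianSurfaceSheafModuli C A p H v M E) (hMd : IsSmoothProjective (2 * 4 + 4) M)
    (e : K ≅ fiberOver f t) (hK : IsSmoothProjective (2 * 4) K) (hKum : IsOfGeneralizedKummerType 4 K)
    (μ : HomologicalOrientation ℂ (ComplexPoints (M ⊗ A.X)) (2 * (2 * 4 + 4 + 2)))
    (ν : HomologicalOrientation ℂ (ComplexPoints M) (2 * (2 * 4 + 4))) (hμ : μ.HasPoincareDuality)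
    (hν : ν.HasPoincareDuality)
    (hgeo : ∃ (ι₀ : Aut K) (g : M ⟶ M), ι₀.hom ≫ (e.hom ≫ fiberι f t) = (e.hom ≫ fiberι f t) ≫ g ∧
      ∀ x ∈ kunnethGenerators C A.X M E μ ν,
        totalPullback ℂ (Motives.AlgPoints.mapContinuous (L := ℂ) g) x = parityOp ℂ (ComplexPoints M) x)
    (ι : Aut K) (h2 : complexBetti.map ι.hom 2 = 𝟙 _) (h3 : complexBetti.map ι.hom 3 = -𝟙 _)
    (c : complexBetti K 8)
    (hc : ∀ γ : Aut K, γ ∈ autFixingH2H3 K → (complexBetti.map γ.hom 8).hom c = c) :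
    (complexBetti.map ι.hom 8).hom c = c :=
  involutionParity_of_parityOnGenerators (n := 4) hY hMk (by norm_num) hM hMd e hK hKum μ ν hμ hν hgeo ι h2 h3 c
    hc

/-! ### §D  The faithful form of LEMMA P's intermediate: parity on ALL of `H*(M_H(v))` (T1 only)

On the twist.  LEMMA P (a) gives `(1 × ι_M)^* ℰ ≅ ((−1) × 1)^* ℰ ⊗ p_M^* N` for a line bundle `N` on `M` with
`c₁(N) + ι_M^* c₁(N) = 0`; the Künneth factors of `ch(ℰ)` itself are then parity eigenvectors only UP TO
multiplication by `ch(N)`, and the parity statement `ι_M^* = (−1)^{deg}` on `H*(M; ℚ)` is obtained from the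
NORMALISED class `𝒸 = ch(ℰ)·e^{c₁(N)/2}` (Markman 2002 Rem. 3: generation is insensitive to `ℚ`-twists).  So the
generator-level hypothesis `hgeo` of §C is the case `c₁(N) = 0` (e.g. after re-choosing the universal family when
`N` is a square), while the statement LEMMA P actually delivers in general is "SOME automorphism of `K` with the
right `H² ∕ H³`-action extends along `j` to an endomorphism of `M` acting by `(−1)^{deg}` on `H*(M(ℂ); ℂ)`" —
the hypothesis `hpar` below, which needs neither T2 nor orientations.  The kernel content of §C beyond §D is
exactly §A (T2: parity on generators ⟹ parity on `H*(M)`). -/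

/-- **LEMMA P's conclusion from its cohomological intermediate (T1 only): if some `ι₀ ∈ Aut K` extends along
`j = e.hom ≫ fiberι f t` to `g : M ⟶ M` with `g^* = (−1)ᵏ` on every `Hᵏ(M(ℂ); ℂ)`, then every automorphism `ι`
of the Kummer moduli space `K` acting as `+1` on `H²` and `−1` on `H³` fixes every `Γ(K)`-invariant class of
`H^{2n}(K(ℂ); ℂ)`** (`n ≥ 2`; `ι₀^* = (−1)ᵏ` on `Im j^*`, which is all of `H²`, `H³` and contains the
`Γ`-invariants by T1; `ι₀⁻¹ι ∈ autFixingH2H3 K` by definition).  The faithful rendering of LEMMA P (a)(b)(d)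
⟹ (A5); kernel, modulo T1 and `hpar`. [cite: Yoshioka2001AbelianSurfaces, §4.1 with Thm. 0.2 (2) and Prop. 4.20]
[cite: Markman2002Generators, Rem. 3 (twist-invariance)] -/
theorem involutionParity_of_parityOnCohomology (hY : Yoshioka2001_kummerFibre_restrictionImage) (hn : 2 ≤ n)
    (hM : AbelianSurfaceSheafModuli C A p H v M E) (hMd : IsSmoothProjective (2 * n + 4) M)
    (e : K ≅ fiberOver f t) (hK : IsSmoothProjective (2 * n) K) (hKum : IsOfGeneralizedKummerType n K)
    (hpar : ∃ (ι₀ : Aut K) (g : M ⟶ M), ι₀.hom ≫ (e.hom ≫ fiberι f t) = (e.hom ≫ fiberι f t) ≫ g ∧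
      ∀ (k : ℕ) (u : complexBetti M k), (complexBetti.map g k).hom u = ((-1 : ℂ) ^ k) • u)
    (ι : Aut K) (h2 : complexBetti.map ι.hom 2 = 𝟙 _) (h3 : complexBetti.map ι.hom 3 = -𝟙 _)
    (c : complexBetti K (2 * n))
    (hc : ∀ γ : Aut K, γ ∈ autFixingH2H3 K → (complexBetti.map γ.hom (2 * n)).hom c = c) :
    (complexBetti.map ι.hom (2 * n)).hom c = c := by
  obtain ⟨ι₀, g, hext, hg⟩ := hpar
  -- `ι₀` on restricted classes
  have hι₀ : ∀ {k : ℕ} {c' : complexBetti K k},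
      c' ∈ LinearMap.range (complexBetti.map (e.hom ≫ fiberι f t) k).hom →
        (complexBetti.map ι₀.hom k).hom c' = ((-1 : ℂ) ^ k) • c' :=
    fun hc' ↦ map_eq_neg_one_pow_smul_of_extends ι₀ g hext hg hc'
  have hι₀2 : complexBetti.map ι₀.hom 2 = 𝟙 _ := by
    ext c'
    have hc' : c' ∈ LinearMap.range (complexBetti.map (e.hom ≫ fiberι f t) 2).hom := by
      rw [hY.range_two hn hM hMd e hK hKum]
      exact Submodule.mem_top
    rw [hι₀ hc']
    norm_num
  have hι₀3 : complexBetti.map ι₀.hom 3 = -𝟙 _ := by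
    ext c'
    have hc' : c' ∈ LinearMap.range (complexBetti.map (e.hom ≫ fiberι f t) 3).hom := by
      rw [hY.range_three hn hM hMd e hK hKum]
      exact Submodule.mem_top
    rw [hι₀ hc', ModuleCat.hom_neg]
    norm_num
  -- the inverse of `ι₀` on `H²`, `H³`
  have hinv2 : complexBetti.map ι₀.inv 2 = 𝟙 _ := by
    have h := complexBetti.map_comp ι₀.inv ι₀.hom 2
    rw [ι₀.inv_hom_id, complexBetti.map_id, hι₀2, Category.id_comp] at h
    exact h.symm
  have hinv3 : complexBetti.map ι₀.inv 3 = -𝟙 _ := by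
    have h := complexBetti.map_comp ι₀.inv ι₀.hom 3
    rw [ι₀.inv_hom_id, complexBetti.map_id, hι₀3, Preadditive.neg_comp, Category.id_comp] at h
    rw [← neg_neg (complexBetti.map ι₀.inv 3), ← h]
  -- `γ = ι₀⁻¹ ι ∈ Γ(K)`
  set γ : Aut K := ι₀.symm ≪≫ ι with hγdef
  have hγ : γ ∈ autFixingH2H3 K := by
    refine (Hyperkaehler.mem_autFixingH2H3_iff γ).2 ⟨?_, ?_⟩
    · change complexBetti.map (ι₀.inv ≫ ι.hom) 2 = 𝟙 _
      rw [complexBetti.map_comp, h2, hinv2, Category.comp_id]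
    · change complexBetti.map (ι₀.inv ≫ ι.hom) 3 = 𝟙 _
      rw [complexBetti.map_comp, h3, hinv3, Preadditive.neg_comp_neg, Category.comp_id]
  -- `ι = ι₀ ≫ γ`, and both fix `c`
  have hιfac : ι.hom = ι₀.hom ≫ γ.hom := by
    change ι.hom = ι₀.hom ≫ (ι₀.inv ≫ ι.hom)
    rw [ι₀.hom_inv_id_assoc]
  have hcr : c ∈ LinearMap.range (complexBetti.map (e.hom ≫ fiberι f t) (2 * n)).hom :=
    hY.mem_range_of_forall_autFixingH2H3 hn hM hMd e hK hKum (2 * n) fun γ' hγ' ↦ hc γ' hγ'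
  have heven : ((-1 : ℂ) ^ (2 * n)) = 1 := by
    rw [pow_mul, neg_one_sq, one_pow]
  rw [hιfac, complexBetti.map_comp, ModuleCat.hom_comp, LinearMap.comp_apply, hc γ hγ, hι₀ hcr, heven, one_smul]

/-- **The `n = 4` shape** of `involutionParity_of_parityOnCohomology` (`2 · 4 = 8`; the hypothesis `hP` of
`Theorems/KummerModuliKumFourClosure.lean`). Kernel, modulo T1 and `hpar`.
[cite: Yoshioka2001AbelianSurfaces, §4.1 with Thm. 0.2 (2) and Prop. 4.20] -/
theorem involutionParity_four_of_parityOnCohomology (hY : Yoshioka2001_kummerFibre_restrictionImage)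
    (hM : AbelianSurfaceSheafModuli C A p H v M E) (hMd : IsSmoothProjective (2 * 4 + 4) M)
    (e : K ≅ fiberOver f t) (hK : IsSmoothProjective (2 * 4) K) (hKum : IsOfGeneralizedKummerType 4 K)
    (hpar : ∃ (ι₀ : Aut K) (g : M ⟶ M), ι₀.hom ≫ (e.hom ≫ fiberι f t) = (e.hom ≫ fiberι f t) ≫ g ∧
      ∀ (k : ℕ) (u : complexBetti M k), (complexBetti.map g k).hom u = ((-1 : ℂ) ^ k) • u)
    (ι : Aut K) (h2 : complexBetti.map ι.hom 2 = 𝟙 _) (h3 : complexBetti.map ι.hom 3 = -𝟙 _)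
    (c : complexBetti K 8)
    (hc : ∀ γ : Aut K, γ ∈ autFixingH2H3 K → (complexBetti.map γ.hom 8).hom c = c) :
    (complexBetti.map ι.hom 8).hom c = c :=
  involutionParity_of_parityOnCohomology (n := 4) hY (by norm_num) hM hMd e hK hKum hpar ι h2 h3 c hc

/-- **§C is §D + §A**: the generator-level hypothesis `hgeo` (untwisted case) yields `hpar` by Markman's theorem
(`map_eq_neg_one_pow_smul_of_kunnethGenerators`), so `involutionParity_of_parityOnGenerators` factors through
`involutionParity_of_parityOnCohomology`. Kernel, modulo T2. [cite: Markman2002Generators, Cor. 2 and Rem. 3] -/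
theorem parityOnCohomology_of_parityOnGenerators
    (hMk : Markman2002_kunnethFactors_generate_cohomology_sheafModuli) (hM : AbelianSurfaceSheafModuli C A p H v M E)
    (hMd : IsSmoothProjective d M) (μ : HomologicalOrientation ℂ (ComplexPoints (M ⊗ A.X)) (2 * (d + 2)))
    (ν : HomologicalOrientation ℂ (ComplexPoints M) (2 * d)) (hμ : μ.HasPoincareDuality)
    (hν : ν.HasPoincareDuality) {j : K ⟶ M}
    (hgeo : ∃ (ι₀ : Aut K) (g : M ⟶ M), ι₀.hom ≫ j = j ≫ g ∧
      ∀ x ∈ kunnethGenerators C A.X M E μ ν,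
        totalPullback ℂ (Motives.AlgPoints.mapContinuous (L := ℂ) g) x = parityOp ℂ (ComplexPoints M) x) :
    ∃ (ι₀ : Aut K) (g : M ⟶ M), ι₀.hom ≫ j = j ≫ g ∧
      ∀ (k : ℕ) (u : complexBetti M k), (complexBetti.map g k).hom u = ((-1 : ℂ) ^ k) • u := by
  obtain ⟨ι₀, g, hext, hgG⟩ := hgeo
  exact ⟨ι₀, g, hext, map_eq_neg_one_pow_smul_of_kunnethGenerators hMk hM hMd μ ν hμ hν g hgG⟩

end Summit.HodgeConjecture.HodgeConjecture.Theorems.KummerModuliMarkmanOnM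

end
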